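import Literature.Analysis.FluidPDE.PeriodicLerayGalerkinPairings
import Literature.Analysis.FluidPDE.PeriodicLerayGalerkinHelmholtz
import Literature.Analysis.FluidPDE.PeriodicLerayCompactness
import Literature.Analysis.FluidPDE.PeriodicLerayMollifiedClasses
import Literature.Analysis.FunctionSpaces.EquicontinuityModuli
import Literature.Analysis.FunctionSpaces.SobolevDomainProofs
import HarnessLib

/-!
# [BT1] proof of Theorem 2.4 — strong `L²` compactness of the Galerkin approximants on cylinders

Analysis/FluidPDE proof file (theorems only; no definitions, no named facts) in the DAG below the
named fact `Literature.Analysis.FluidPDE.bradshawTsai2017_thm_2_4_mollified`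
(`PeriodicLerayExistence.lean`; Bradshaw–Tsai, Ann. Henri Poincaré 18 (2017) = arXiv:1510.07504
[BT1], proof of Thm 2.4, the limit `k → ∞`: "Standard arguments (e.g. those in Temam, Ch. III)
imply that … `U_k → U_ε` strongly in `L²(0,T;L²(K))` for all compact sets `K ⊂ ℝ³`").

`exists_subseq_strong_limit_galerkin`: for the `T`-periodic solutions `b_k` of the Galerkin
systems of [BT1] Lemma 2.6 on the Galerkin spaces `V_k` of a `C¹`-dense family of `𝒱`
(orthonormal bases `a_k`), with the uniform bounds `‖b_k(s)‖² ≤ C_b` and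
`∫₀ᵀ ∫ |∇U_k|² ≤ C_d` (`U_k(s) = Σᵢ b_{ki}(s) a_{ki}`), on every cylinder `(a, b) × B(x₀, R)` a
subsequence of `U_k` converges strongly in `L²` (and slice-wise in `𝒟'`, a.e. in time) to a
jointly measurable `u` with `∫_{B} ‖u(t)‖² ≤ C_b` for a.e. `t`. This is the tree's generic
Aubin–Lions theorem `AubinLions.exists_subseq_strong_limit_of_equicontinuous`; its one
non-trivial input, the equicontinuity of the pairings `t ↦ ∫ φ • U_k(t)` *uniformly in `k`*, is
obtained from the Galerkin equations through the uniform modulus of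
`PeriodicLerayGalerkinPairings.exists_pairing_modulus` (test fields in some `V_m`, `k ≥ m`), the
`L²` approximation of the Leray projection of `φ eᵢ` by elements of `⋃ V_m`
(`PeriodicLerayGalerkinHelmholtz`), finite families for `k < m` and the countable-infimum modulus
(`FunctionSpaces.EquicontinuityModuli`).

## Mathlib / tree search

Tree (all used): `AubinLions.exists_subseq_strong_limit_of_equicontinuous`,
`isLipschitzDomain_ball` (`AubinLionsExtraction` & co.); `HasWeakFDerivOn.of_contDiff_holds`
(`SobolevDomainProofs`); `exists_pairing_modulus` (`PeriodicLerayGalerkinPairings`);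
`exists_galerkinSpace_approx`, `abs_integral_inner_sub_le` (`PeriodicLerayGalerkinHelmholtz`);
`AubinLions.exists_modulus_finset / tendsto_iInf_add_modulus` (`EquicontinuityModuli`);
`setLIntegral_Ioo_prod_le_of_periodic`, `norm_le_sum_abs_inner_basisFun`,
`NSCylinder.inner_integral_smul_eq / isTestFunctionOn_smul_const / lintegral_enorm_sq_le_of_frobenius`
(`PeriodicLerayCompactness`, `NSCylinderVelocityCompactness`); `galerkinSum` API
(`PeriodicLerayGalerkinSystem`), `continuous_dissipation_galerkinSum` (`PeriodicLerayGalerkin`),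
`volume_restrict_prod_univ` (`PeriodicLerayMollifiedClasses`).

## References

* Z. Bradshaw, T.-P. Tsai, Ann. Henri Poincaré 18 (2017) = arXiv:1510.07504, proof of Thm 2.4
  (limit `k → ∞`) [BradshawTsai2017AHP].
* R. Temam, *Navier–Stokes equations* (1977/79), Ch. III §§2–3 [Temam1979].
-/

noncomputable section

open MeasureTheory Set Function Filter Topology TopologicalSpace Metric
open Literature.Analysis.FunctionSpaces
open scoped NNReal ENNReal InnerProductSpace RealInnerProductSpace

namespace Literature.Analysis.FluidPDE

namespace BradshawTsai2017

section GalerkinCompactness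

variable {T : ℝ} {W : ℝ → EuclideanSpace ℝ (Fin 3) → EuclideanSpace ℝ (Fin 3)}
  {ρ : EuclideanSpace ℝ (Fin 3) → ℝ}

/-- `∫⁻ ‖g‖ₑ² = ofReal ∫ ‖g‖²` for a continuous compactly supported field. [folklore] -/
theorem lintegral_enorm_sq_eq_ofReal_of_continuous {g : EuclideanSpace ℝ (Fin 3) → EuclideanSpace ℝ (Fin 3)}
    (hg : Continuous g) (hgs : HasCompactSupport g) :
    ∫⁻ x, ‖g x‖ₑ ^ 2 = ENNReal.ofReal (∫ x, ‖g x‖ ^ 2) := by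
  have hint : Integrable (fun x => ‖g x‖ ^ 2) volume :=
    (memLp_two_iff_integrable_sq_norm hg.aestronglyMeasurable).1 (hg.memLp_of_hasCompactSupport hgs)
  rw [ofReal_integral_eq_lintegral_ofReal hint (ae_of_all _ fun x => sq_nonneg _)]
  refine lintegral_congr fun x => ?_
  rw [← ofReal_norm, ENNReal.ofReal_pow (norm_nonneg _)]

/-- The Frobenius dissipation density of a test field is integrable. [folklore] -/
theorem integrable_frobeniusNormSq_fderiv {g : EuclideanSpace ℝ (Fin 3) → EuclideanSpace ℝ (Fin 3)}
    (hg : IsTestFunctionOn (⊤ : Opens (EuclideanSpace ℝ (Fin 3))) g) :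
    Integrable (fun y => frobeniusNormSq (fderiv ℝ g y)) volume := by
  have hc : Continuous fun y => frobeniusNormSq (fderiv ℝ g y) :=
    continuous_frobeniusNormSq_comp (hg.contDiff.continuous_fderiv (by simp))
  refine hc.integrable_of_hasCompactSupport ?_
  refine HasCompactSupport.intro (hg.hasCompactSupport.fderiv ℝ) fun y hy => ?_
  rw [image_eq_zero_of_notMem_tsupport hy, frobeniusNormSq_zero]

set_option maxHeartbeats 1600000 in
/-- **Strong `L²` compactness of the Galerkin approximants on a cylinder** ([BT1], proof of
Thm 2.4, limit `k → ∞`; Temam, Ch. III, Thm. 2.1 / proof of Thm. 3.1). See the module docstring.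
[cite: BradshawTsai2017AHP, proof of Thm 2.4 (limit k → ∞); Temam1979, Ch. III §3] -/
theorem exists_subseq_strong_limit_galerkin (hT : 0 < T) (hW : ContDiff ℝ 1 (uncurry W))
    (hWper : ∀ s y, W (s + T) y = W s y)
    (hℓ : ∀ g : EuclideanSpace ℝ (Fin 3) → EuclideanSpace ℝ (Fin 3),
      IsTestFunctionOn (⊤ : Opens (EuclideanSpace ℝ (Fin 3))) g → ∃ Cℓ : ℝ, ∀ s, |lerayPairing W s g| ≤ Cℓ)
    (hρ : Continuous ρ) (hρc : HasCompactSupport ρ)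
    {σ : ℕ → EuclideanSpace ℝ (Fin 3) → EuclideanSpace ℝ (Fin 3)}
    (hσ : ∀ n, σ n ∈ testDivFreeSubmodule)
    (hσd : ∀ (N : ℕ) (ζ : EuclideanSpace ℝ (Fin 3) → EuclideanSpace ℝ (Fin 3)),
      ζ ∈ testDivFreeSubmodule → tsupport ζ ⊆ closedBall (0 : EuclideanSpace ℝ (Fin 3)) N →
        ∀ δ : ℝ, 0 < δ → ∃ n, tsupport (σ n) ⊆ closedBall (0 : EuclideanSpace ℝ (Fin 3)) N ∧
          ∀ y, ‖ζ y - σ n y‖ ≤ δ ∧ ‖fderiv ℝ ζ y - fderiv ℝ (σ n) y‖ ≤ δ)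
    {kk : ℕ → ℕ} {a : ∀ m, Fin (kk m) → EuclideanSpace ℝ (Fin 3) → EuclideanSpace ℝ (Fin 3)}
    {b : ∀ m, ℝ → EuclideanSpace ℝ (Fin (kk m))}
    (haV : ∀ m i, a m i ∈ testDivFreeSubmodule)
    (hon : ∀ m i j, ∫ y, ⟪a m i y, a m j y⟫ = if i = j then (1 : ℝ) else 0)
    (hgal : ∀ m, ∀ g ∈ galerkinSpace σ m, ∃ c : EuclideanSpace ℝ (Fin (kk m)), galerkinSum (a m) c = g)
    (hb : ∀ m s, HasDerivAt (b m) (galerkinRHS W ρ (a m) s (b m s)) s)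
    (hbT : ∀ m s, b m (s + T) = b m s)
    {Cb Cd : ℝ} (hCb0 : 0 ≤ Cb) (hCd0 : 0 ≤ Cd) (hCb : ∀ m s, ‖b m s‖ ^ 2 ≤ Cb)
    (hCd : ∀ m, ∫ s in (0 : ℝ)..T, (∫ y, frobeniusNormSq (fderiv ℝ (galerkinSum (a m) (b m s)) y)) ≤ Cd)
    (a₀ b₀ : ℝ) (x₀ : EuclideanSpace ℝ (Fin 3)) (R : ℝ) :
    ∃ (φs : ℕ → ℕ) (u : ℝ → EuclideanSpace ℝ (Fin 3) → EuclideanSpace ℝ (Fin 3)), StrictMono φs ∧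
      AEStronglyMeasurable (uncurry u) (volume.restrict (Ioo a₀ b₀ ×ˢ ball x₀ R)) ∧
      (∀ᵐ t ∂(volume.restrict (Ioo a₀ b₀)), ∫⁻ x in ball x₀ R, ‖u t x‖ₑ ^ 2 ≤ ENNReal.ofReal Cb) ∧
      Tendsto (fun i => ∫⁻ z in Ioo a₀ b₀ ×ˢ ball x₀ R,
        ‖galerkinSum (a (φs i)) (b (φs i) z.1) z.2 - u z.1 z.2‖ₑ ^ 2) atTop (𝓝 0) ∧
      ∀ φ : EuclideanSpace ℝ (Fin 3) → ℝ,
        IsTestFunctionOn (⟨ball x₀ R, isOpen_ball⟩ : Opens (EuclideanSpace ℝ (Fin 3))) φ →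
        ∀ᵐ t ∂(volume.restrict (Ioo a₀ b₀)),
          Tendsto (fun i => ∫ x in ball x₀ R, φ x • galerkinSum (a (φs i)) (b (φs i) t) x) atTop
            (𝓝 (∫ x in ball x₀ R, φ x • u t x)) := by
  set Ω : Opens (EuclideanSpace ℝ (Fin 3)) := ⟨ball x₀ R, isOpen_ball⟩ with hΩ
  haveI : IsFiniteMeasure ((volume : Measure (EuclideanSpace ℝ (Fin 3))).restrict (ball x₀ R)) :=
    ⟨by rw [Measure.restrict_apply_univ]; exact measure_ball_lt_top⟩
  -- ## the approximants
  set v : ℕ → ℝ → EuclideanSpace ℝ (Fin 3) → EuclideanSpace ℝ (Fin 3) :=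
    fun k t y => galerkinSum (a k) (b k t) y with hv
  have ha : ∀ m i, IsTestFunctionOn (⊤ : Opens (EuclideanSpace ℝ (Fin 3))) (a m i) :=
    fun m i => (mem_testDivFreeSubmodule.1 (haV m i)).1
  have ha1 : ∀ m i, ContDiff ℝ 1 (a m i) := fun m i => (ha m i).contDiff.of_le (by exact_mod_cast le_top)
  have had : ∀ m i, Differentiable ℝ (a m i) := fun m i => (ha1 m i).differentiable one_ne_zero
  have hac : ∀ m i, Continuous (a m i) := fun m i => (ha m i).contDiff.continuous
  have has : ∀ m i, HasCompactSupport (a m i) := fun m i => (ha m i).hasCompactSupport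
  have hbc : ∀ m, Continuous (b m) := fun m =>
    continuous_iff_continuousAt.2 fun s => (hb m s).continuousAt
  have hvtest : ∀ k t, IsTestFunctionOn (⊤ : Opens (EuclideanSpace ℝ (Fin 3))) (v k t) :=
    fun k t => isTestFunctionOn_galerkinSum (ha k) (b k t)
  have hvV : ∀ k t, v k t ∈ testDivFreeSubmodule := by
    intro k t
    have e : v k t = ∑ i, b k t i • a k i := by
      funext y; simp only [hv, galerkinSum_apply, Finset.sum_apply, Pi.smul_apply]
    rw [e]
    exact Submodule.sum_mem _ fun i _ => Submodule.smul_mem _ _ (haV k i)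
  have hvE : ∀ k t, ∫ y, ‖v k t y‖ ^ 2 ≤ Cb := fun k t => by
    simp only [hv]
    rw [integral_norm_sq_galerkinSum (hac k) (has k) (hon k) (b k t)]
    exact hCb k t
  have hvper : ∀ k t, v k (t + T) = v k t := fun k t => by
    funext y; simp only [hv, hbT k t]
  -- joint continuity
  have hvj : ∀ k, Continuous (uncurry (v k)) := fun k => by
    have e : uncurry (v k) = fun z : ℝ × EuclideanSpace ℝ (Fin 3) => ∑ i, b k z.1 i • a k i z.2 := by
      funext z; simp only [uncurry, hv, galerkinSum_apply]
    rw [e]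
    refine continuous_finsetSum _ fun i _ => ?_
    exact ((PiLp.continuous_apply 2 _ i).comp ((hbc k).comp continuous_fst)).smul
      ((hac k i).comp continuous_snd)
  set G : ℕ → ℝ → EuclideanSpace ℝ (Fin 3) → EuclideanSpace ℝ (Fin 3) →L[ℝ] EuclideanSpace ℝ (Fin 3) :=
    fun k t y => fderiv ℝ (v k t) y with hGdef
  have hGj : ∀ k, Continuous (uncurry (G k)) := fun k => by
    have e : uncurry (G k) =
        fun z : ℝ × EuclideanSpace ℝ (Fin 3) => ∑ i, b k z.1 i • fderiv ℝ (a k i) z.2 := by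
      funext z
      simp only [uncurry, hGdef, hv]
      exact fderiv_galerkinSum (had k) _ _
    rw [e]
    refine continuous_finsetSum _ fun i _ => ?_
    exact ((PiLp.continuous_apply 2 _ i).comp ((hbc k).comp continuous_fst)).smul
      (((ha1 k i).continuous_fderiv one_ne_zero).comp continuous_snd)
  -- ## the hypotheses of the Aubin–Lions theorem
  have hvm : ∀ k, AEStronglyMeasurable (uncurry (v k)) (volume.restrict (Ioo a₀ b₀ ×ˢ ball x₀ R)) :=
    fun k => (hvj k).aestronglyMeasurable.restrict
  have hvEn : ∀ k, ∀ᵐ t ∂(volume.restrict (Ioo a₀ b₀)),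
      ∫⁻ x in ball x₀ R, ‖v k t x‖ₑ ^ 2 ≤ ENNReal.ofReal Cb := fun k => ae_of_all _ fun t => by
    calc ∫⁻ x in ball x₀ R, ‖v k t x‖ₑ ^ 2 ≤ ∫⁻ x, ‖v k t x‖ₑ ^ 2 := lintegral_mono_set (subset_univ _) |>.trans
            (by rw [Measure.restrict_univ])
      _ = ENNReal.ofReal (∫ x, ‖v k t x‖ ^ 2) :=
          lintegral_enorm_sq_eq_ofReal_of_continuous (hvtest k t).contDiff.continuous (hvtest k t).hasCompactSupport
      _ ≤ ENNReal.ofReal Cb := ENNReal.ofReal_le_ofReal (hvE k t)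
  have hGm : ∀ k, AEStronglyMeasurable (uncurry (G k))
      (volume.restrict (Ioo a₀ b₀ ×ˢ ball x₀ R)) := fun k => (hGj k).aestronglyMeasurable.restrict
  have hGs : ∀ k, ∀ᵐ t ∂(volume.restrict (Ioo a₀ b₀)),
      HasWeakFDerivOn Ω volume (v k t) (G k t) := fun k =>
    ae_of_all _ fun t => HasWeakFDerivOn.of_contDiff_holds Ω volume
      ((hvtest k t).contDiff.of_le (by exact_mod_cast le_top))
  -- the dissipation bound on the window
  set Cg : ℝ≥0∞ := 2 * (⌈(b₀ - a₀) / T⌉₊ + 1 : ℕ) * ENNReal.ofReal Cd with hCg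
  have hCgtop : Cg ≠ ⊤ :=
    ENNReal.mul_ne_top (ENNReal.mul_ne_top ENNReal.ofNat_ne_top (ENNReal.natCast_ne_top _))
      ENNReal.ofReal_ne_top
  have hD0T : ∀ k, ∫⁻ z in Ioo 0 T ×ˢ (univ : Set (EuclideanSpace ℝ (Fin 3))),
      ENNReal.ofReal (frobeniusNormSq (G k z.1 z.2)) ≤ ENNReal.ofReal Cd := by
    intro k
    have hmeas : AEMeasurable (fun z : ℝ × EuclideanSpace ℝ (Fin 3) =>
        ENNReal.ofReal (frobeniusNormSq (G k z.1 z.2)))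
        (((volume : Measure ℝ).restrict (Ioo 0 T)).prod (volume : Measure (EuclideanSpace ℝ (Fin 3)))) :=
      (ENNReal.continuous_ofReal.comp (continuous_frobeniusNormSq_comp (hGj k))).measurable.aemeasurable
    rw [volume_restrict_prod_univ, lintegral_prod _ hmeas]
    have hin : ∀ t, ∫⁻ y, ENNReal.ofReal (frobeniusNormSq (G k t y)) =
        ENNReal.ofReal (∫ y, frobeniusNormSq (G k t y)) := fun t =>
      (ofReal_integral_eq_lintegral_ofReal (integrable_frobeniusNormSq_fderiv (hvtest k t))
        (ae_of_all _ fun _ => frobeniusNormSq_nonneg _)).symm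
    simp_rw [hin]
    set D : ℝ → ℝ := fun t => ∫ y, frobeniusNormSq (G k t y) with hD
    have hDc : Continuous D := by
      have h := continuous_dissipation_galerkinSum (ha k) (hbc k)
      exact h
    have hD0 : ∀ t, 0 ≤ D t := fun t => integral_nonneg fun _ => frobeniusNormSq_nonneg _
    have hDi : IntegrableOn D (Ioo 0 T) volume := (hDc.integrableOn_Icc).mono_set Ioo_subset_Icc_self
    rw [← ofReal_integral_eq_lintegral_ofReal hDi (ae_of_all _ fun t => hD0 t)]
    refine ENNReal.ofReal_le_ofReal ?_
    have e : ∫ t in Ioo 0 T, D t = ∫ t in (0 : ℝ)..T, D t := by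
      rw [intervalIntegral.integral_of_le hT.le, integral_Ioc_eq_integral_Ioo]
    rw [e]
    exact hCd k
  have hGper : ∀ k s y, G k (s + T) y = G k s y := fun k s y => by
    simp only [hGdef, hvper k s]
  have hGb : ∀ k, ∫⁻ z in Ioo a₀ b₀ ×ˢ ball x₀ R, ‖G k z.1 z.2‖ₑ ^ 2 ≤ Cg := fun k => by
    refine NSCylinder.lintegral_enorm_sq_le_of_frobenius (G := G k) ?_
    refine (lintegral_mono_set (prod_mono Subset.rfl (subset_univ _))).trans ?_
    refine (setLIntegral_Ioo_prod_le_of_periodic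
      (f := fun z : ℝ × EuclideanSpace ℝ (Fin 3) => ENNReal.ofReal (frobeniusNormSq (G k z.1 z.2)))
      hT (fun s y => by simp only [hGper k s]) a₀ b₀).trans ?_
    rw [hCg]
    exact mul_le_mul' le_rfl (hD0T k)
  -- ## equicontinuity of the pairings
  have hEC : ∀ φ : EuclideanSpace ℝ (Fin 3) → ℝ, IsTestFunctionOn Ω φ →
      ∃ ω : ℝ → ℝ, Tendsto ω (𝓝 0) (𝓝 0) ∧
        ∀ k, ∃ S : Set ℝ, (∀ᵐ t ∂(volume.restrict (Ioo a₀ b₀)), t ∈ S) ∧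
          ∀ t ∈ S, ∀ s ∈ S, ‖(∫ x in (Ω : Set (EuclideanSpace ℝ (Fin 3))), φ x • v k t x) -
            ∫ x in (Ω : Set (EuclideanSpace ℝ (Fin 3))), φ x • v k s x‖ ≤ ω (t - s) := by
    intro φ hφ
    -- the coordinate test fields `ζ_i = φ e_i` (test fields on the whole space) and their classes
    set ζ : Fin 3 → EuclideanSpace ℝ (Fin 3) → EuclideanSpace ℝ (Fin 3) :=
      fun i x => φ x • EuclideanSpace.basisFun (Fin 3) ℝ i with hζ
    have hζΩ : ∀ i, IsTestFunctionOn Ω (ζ i) := fun i => NSCylinder.isTestFunctionOn_smul_const hφ _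
    have hζt : ∀ i, IsTestFunctionOn (⊤ : Opens (EuclideanSpace ℝ (Fin 3))) (ζ i) := fun i =>
      ⟨(hζΩ i).contDiff, (hζΩ i).hasCompactSupport, fun _ _ => trivial⟩
    have hζ2 : ∀ i, MemLp (ζ i) 2 (volume : Measure (EuclideanSpace ℝ (Fin 3))) := fun i =>
      (hζt i).contDiff.continuous.memLp_of_hasCompactSupport (hζt i).hasCompactSupport
    -- the coordinate pairings
    set P : Fin 3 → ℕ → ℝ → ℝ := fun i k t => ∫ y, ⟪v k t y, ζ i y⟫ with hP
    -- ### a modulus for each coordinate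
    have hcoord : ∀ i, ∃ ω : ℝ → ℝ, Tendsto ω (𝓝 0) (𝓝 0) ∧ (∀ δ, 0 ≤ ω δ) ∧
        ∀ k t s, |P i k t - P i k s| ≤ ω (t - s) := by
      intro i
      -- for each `n`: an element `g_n ∈ 𝒱 ∩ V_{m_n}` with `‖P[ζ_i] − [g_n]‖ ≤ 1/(n+1)`
      have hstep : ∀ n : ℕ, ∃ (εn : ℝ) (ωn : ℝ → ℝ), 0 ≤ εn ∧ εn ≤ 2 * Real.sqrt Cb / (n + 1) ∧
          Tendsto ωn (𝓝 0) (𝓝 0) ∧ (∀ δ, 0 ≤ ωn δ) ∧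
          ∀ k t s, |P i k t - P i k s| ≤ εn + ωn (t - s) := by
        intro n
        have hδn : (0 : ℝ) < 1 / (n + 1) := by positivity
        obtain ⟨m, g, hg, hgV, hgδ⟩ := exists_galerkinSpace_approx hσ hσd
          ⟨lerayProjector (EuclideanSpace ℝ (Fin 3)) ((hζ2 i).toLp (ζ i)), lerayProjector_apply_mem _⟩ hδn
        have hgt : IsTestFunctionOn (⊤ : Opens (EuclideanSpace ℝ (Fin 3))) g := (mem_testDivFreeSubmodule.1 hg).1
        -- the pairings with `g`
        set Q : ℕ → ℝ → ℝ := fun k t => ∫ y, ⟪v k t y, g y⟫ with hQ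
        -- `|P − Q| ≤ √Cb / (n+1)`
        have hPQ : ∀ k t, |P i k t - Q k t| ≤ Real.sqrt Cb * (1 / (n + 1)) := by
          intro k t
          have h := abs_integral_inner_sub_le (hvV k t) (hvE k t) ((hζ2 i).toLp (ζ i)) hg hgδ
          have e : (∫ y, ⟪v k t y, (((hζ2 i).toLp (ζ i) : Lp (EuclideanSpace ℝ (Fin 3)) 2
              (volume : Measure (EuclideanSpace ℝ (Fin 3)))) : EuclideanSpace ℝ (Fin 3) → EuclideanSpace ℝ (Fin 3)) y⟫) =
              P i k t := by
            simp only [hP]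
            refine integral_congr_ae ?_
            filter_upwards [(hζ2 i).coeFn_toLp] with y hy
            rw [hy]
          rw [e] at h
          exact h
        -- `Q k` is continuous and `T`-periodic
        have hQc : ∀ k, Continuous (Q k) := by
          intro k
          have hj : Continuous (uncurry fun t y => ⟪v k t y, g y⟫) :=
            (hvj k).inner (hgt.contDiff.continuous.comp continuous_snd)
          have h := continuous_parametric_integral_of_continuous (μ := (volume : Measure (EuclideanSpace ℝ (Fin 3))))
            hj hgt.hasCompactSupport.isCompact
          refine h.congr fun t => ?_
          refine setIntegral_eq_integral_of_forall_compl_eq_zero fun y hy => ?_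
          rw [image_eq_zero_of_notMem_tsupport hy, inner_zero_right]
        have hQper : ∀ k, Function.Periodic (Q k) T := fun k t => by
          simp only [hQ, hvper k t]
        -- the modulus for `k ≥ m` from the Galerkin equations
        obtain ⟨Cℓ, hCℓ⟩ := hℓ g hgt
        obtain ⟨K₁, K₂, hK₁, hK₂, hmod⟩ := exists_pairing_modulus (ρ := ρ) hT hW hWper hρ hρc hgt hCℓ hCb0 hCd0
        have hbig : ∀ k, m ≤ k → ∀ t s, |Q k t - Q k s| ≤
            K₁ * min |t - s| T + K₂ * Real.sqrt (min |t - s| T) := by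
          intro k hk t s
          obtain ⟨c, hc⟩ := hgal k g (galerkinSpace_mono σ hk hgV)
          have hE1 := hmod (ha k) (hon k) (hb k) (hbT k) (hCb k) (hCd k) c hc
          -- reduce to `lo ≤ hi' ≤ lo + T` by periodicity
          have key : ∀ t s, s ≤ t → |Q k t - Q k s| ≤ K₁ * min |t - s| T + K₂ * Real.sqrt (min |t - s| T) := by
            intro t s hst
            set j : ℕ := ⌊(t - s) / T⌋₊ with hj
            set t' : ℝ := t - j * T with ht'
            have hjle : (j : ℝ) * T ≤ t - s := by
              have := Nat.floor_le (div_nonneg (sub_nonneg.2 hst) hT.le)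
              rw [← hj] at this
              exact (le_div_iff₀ hT).1 this
            have hjlt : t - s < (j + 1 : ℝ) * T := by
              have := Nat.lt_floor_add_one ((t - s) / T)
              rw [← hj] at this
              exact (div_lt_iff₀ hT).1 this
            have h1 : s ≤ t' := by rw [ht']; linarith
            have h2 : t' ≤ s + T := by rw [ht']; nlinarith
            have h3 : t' - s ≤ min |t - s| T := by
              refine le_min ?_ (by linarith)
              rw [abs_of_nonneg (sub_nonneg.2 hst), ht']
              nlinarith [hT, (Nat.cast_nonneg j : (0 : ℝ) ≤ j)]
            have h4 : 0 ≤ t' - s := sub_nonneg.2 h1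
            have hQt : Q k t' = Q k t := (hQper k).sub_nat_mul_eq j
            have hE := hE1 s t' h1 h2
            rw [show (∫ y, ⟪galerkinSum (a k) (b k t') y, g y⟫) = Q k t' from rfl,
              show (∫ y, ⟪galerkinSum (a k) (b k s) y, g y⟫) = Q k s from rfl, hQt] at hE
            calc |Q k t - Q k s| ≤ K₁ * (t' - s) + K₂ * Real.sqrt (t' - s) := hE
              _ ≤ K₁ * min |t - s| T + K₂ * Real.sqrt (min |t - s| T) := by
                  gcongr
          rcases le_total s t with hst | hts
          · exact key t s hst
          · rw [abs_sub_comm (Q k t), abs_sub_comm t]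
            exact key s t hts
        -- the modulus for `k < m` (finitely many continuous periodic functions)
        obtain ⟨ωf, hωf, hωf0, hωfle⟩ := AubinLions.exists_modulus_finset (Finset.range m)
          (f := fun k => Q k) hT (fun k _ => hQc k) (fun k _ => hQper k)
        refine ⟨2 * (Real.sqrt Cb * (1 / (n + 1))),
          fun δ => ωf δ + (K₁ * min |δ| T + K₂ * Real.sqrt (min |δ| T)), by positivity,
          le_of_eq (by ring), ?_, fun δ => ?_, fun k t s => ?_⟩
        · have hc : Continuous fun δ : ℝ => K₁ * min |δ| T + K₂ * Real.sqrt (min |δ| T) :=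
            (continuous_const.mul (continuous_abs.min continuous_const)).add
              (continuous_const.mul (continuous_abs.min continuous_const).sqrt)
          have h0 := hc.tendsto 0
          simp only [abs_zero, min_eq_left hT.le, Real.sqrt_zero, mul_zero, add_zero] at h0
          simpa using hωf.add h0
        · have : 0 ≤ min |δ| T := le_min (abs_nonneg _) hT.le
          have := hωf0 δ
          positivity
        · -- `|P t − P s| ≤ |P t − Q t| + |Q t − Q s| + |Q s − P s|`
          have hmid : |Q k t - Q k s| ≤ ωf (t - s) + (K₁ * min |t - s| T + K₂ * Real.sqrt (min |t - s| T)) := by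
            rcases Nat.lt_or_ge k m with hk | hk
            · have h := hωfle k (Finset.mem_range.2 hk) t s
              rw [Real.norm_eq_abs] at h
              have : 0 ≤ K₁ * min |t - s| T + K₂ * Real.sqrt (min |t - s| T) := by
                have : 0 ≤ min |t - s| T := le_min (abs_nonneg _) hT.le
                positivity
              linarith
            · have h := hbig k hk t s
              linarith [hωf0 (t - s)]
          have e : P i k t - P i k s = (P i k t - Q k t) + (Q k t - Q k s) - (P i k s - Q k s) := by ring
          rw [e]
          have h3 : ∀ x y z : ℝ, |x + y - z| ≤ |x| + |y| + |z| := fun x y z => by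
            rw [abs_le]
            constructor <;> linarith [neg_abs_le x, le_abs_self x, neg_abs_le y, le_abs_self y,
              neg_abs_le z, le_abs_self z]
          calc |(P i k t - Q k t) + (Q k t - Q k s) - (P i k s - Q k s)|
              ≤ |P i k t - Q k t| + |Q k t - Q k s| + |P i k s - Q k s| := h3 _ _ _
            _ ≤ Real.sqrt Cb * (1 / (n + 1)) + (ωf (t - s) + (K₁ * min |t - s| T +
                K₂ * Real.sqrt (min |t - s| T))) + Real.sqrt Cb * (1 / (n + 1)) :=
                add_le_add (add_le_add (hPQ k t) hmid) (hPQ k s)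
            _ = _ := by ring
      choose εn ωn hε0 hεle hωn hωn0 hPle using hstep
      have hεt : Tendsto εn atTop (𝓝 0) := by
        have h2 : Tendsto (fun n : ℕ => 2 * Real.sqrt Cb / ((n : ℝ) + 1)) atTop (𝓝 0) := by
          have h := tendsto_one_div_add_atTop_nhds_zero_nat.const_mul (2 * Real.sqrt Cb)
          rw [mul_zero] at h
          refine h.congr fun n => ?_
          ring
        exact squeeze_zero hε0 hεle h2
      obtain ⟨hlim, hnn, hle⟩ := AubinLions.tendsto_iInf_add_modulus hε0 hεt hωn0 hωn
      exact ⟨fun δ => ⨅ n, (εn n + ωn n δ), hlim, hnn, fun k t s =>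
        le_ciInf fun n => (hPle n k t s).trans le_rfl⟩
    -- ### sum over the coordinates
    choose ω hω hω0 hωle using hcoord
    refine ⟨fun δ => ∑ i, ω i δ, ?_, fun k => ⟨univ, ae_of_all _ fun _ => trivial, fun t _ s _ => ?_⟩⟩
    · have h := tendsto_finsetSum (Finset.univ : Finset (Fin 3)) fun i _ => hω i
      simpa using h
    have hint : ∀ t, Integrable (fun x => φ x • v k t x) (volume.restrict (ball x₀ R)) := fun t =>
      ((hφ.contDiff.continuous.smul (hvtest k t).contDiff.continuous).integrable_of_hasCompactSupport
        (hφ.hasCompactSupport.smul_right)).restrict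
    have hφ0 : ∀ x, x ∉ ball x₀ R → φ x = 0 := fun x hx =>
      image_eq_zero_of_notMem_tsupport fun h => hx (hφ.tsupport_subset h)
    calc ‖(∫ x in (Ω : Set (EuclideanSpace ℝ (Fin 3))), φ x • v k t x) -
          ∫ x in (Ω : Set (EuclideanSpace ℝ (Fin 3))), φ x • v k s x‖
        ≤ ∑ i, |⟪(∫ x in (Ω : Set (EuclideanSpace ℝ (Fin 3))), φ x • v k t x) -
            ∫ x in (Ω : Set (EuclideanSpace ℝ (Fin 3))), φ x • v k s x,
            EuclideanSpace.basisFun (Fin 3) ℝ i⟫| := norm_le_sum_abs_inner_basisFun _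
      _ = ∑ i, |P i k t - P i k s| := by
          refine Finset.sum_congr rfl fun i _ => ?_
          rw [inner_sub_left, NSCylinder.inner_integral_smul_eq (Ω := Ω) (hint t),
            NSCylinder.inner_integral_smul_eq (Ω := Ω) (hint s)]
          congr 2 <;>
          · refine setIntegral_eq_integral_of_forall_compl_eq_zero fun x hx => ?_
            show ⟪v k _ x, φ x • EuclideanSpace.basisFun (Fin 3) ℝ i⟫ = 0
            rw [hφ0 x hx, zero_smul, inner_zero_right]
      _ ≤ ∑ i, ω i (t - s) := Finset.sum_le_sum fun i _ => hωle i k t s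
  -- ## the abstract compactness theorem
  obtain ⟨φs, u, hφs, hum, huE, hus, huP⟩ :=
    AubinLions.exists_subseq_strong_limit_of_equicontinuous (F := EuclideanSpace ℝ (Fin 3))
      (isLipschitzDomain_ball x₀ R) isBounded_ball ENNReal.ofReal_ne_top hCgtop hvm hvEn hGm hGs hGb hEC
  exact ⟨φs, u, hφs, hum, huE, hus, huP⟩

end GalerkinCompactness

end BradshawTsai2017

end Literature.Analysis.FluidPDE

end
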